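import Literature.MathematicalPhysics.QuantumFieldTheory.Balaban1983to89.B6SectACriticalPointV1
import Literature.MathematicalPhysics.QuantumFieldTheory.BalabanImbrieJaffe1984to88.BIJ85TreeGaugeLineSums

/-!
# `Balaban1983to89.B6Ineq2118LowerMultiLevelV1` — T. Bałaban, *Propagators and renormalization transformations for lattice gauge theories. II*,
# Commun. Math. Phys. **96** (1984) 223–250 [Balaban1984PropagatorsII], p. 243 (2.118) ∕ p. 249 (2.153) with [I] = *… I*, Commun. Math. Phys. **95** (1984)
# 17–40 [Balaban1984PropagatorsI] (1.65)–(1.67) p. 29: **THE LOWER HALF OF (2.118), `⟨B, Δ_kB⟩ ≥ γ₀‖∂₁B‖²`, FOR THE MULTI-LEVEL V1 OPERATOR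
# `Δ_k = (QGQ*)⁻¹ − a` OF p21's `B6SectAVectorModelV1`, IN POSITION SPACE** — the Schur step `⟨B,(QGQ*)⁻¹B⟩ − ⟨B,aB⟩ = ‖∂(HB)‖²`, the L² Jensen
# inequality «the curl of a block average is an average of fluxes», the propagation of the multi-scale constraints to the top torus, and their assembly

statement-level skeleton of published theorems with citation tags; proofs where landed; nothing here is a claim about the Yang–Mills mass gap.

THE PRINT (verbatim).  [I] p. 29: *«The action Δ_k is thus defined by ⟨B, Δ_kB⟩ = ⟨∂H_kB, ∂H_kB⟩. (1.65) … γ₀⟨∂₁B, ∂₁B⟩ ≤ ⟨B, Δ_kB⟩ ≤ γ₁⟨∂₁B, ∂₁B⟩. (1.67)»*;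
[Balaban1984PropagatorsII] p. 243: *«the quadratic forms are equal to ⟨B, Δ_jB⟩ given by (1.66) and satisfying (1.67): (2.118)»*; p. 228: *«A = HB =
GQ*(QGQ*)⁻¹B. (2.35)»*; p. 249: *«Using (2.118) and (2.128) we get ⟨B, Δ_kB⟩ ≥ (γ₀∕12d²)L^{−d−1}‖B‖² … (2.153) on the subspace of B satisfying: QB = 0,
B(Γ_{y,x}) = 0 for x ∈ B(y)»*, applied *«on the whole lattice T^{(k)}, or on a subset Λ ⊂ T^{(k)}»*; p. 226: *«Δ_a = ∂*∂ + ∂R∂* + Q*aQ (2.19)»*, *«(QA)(b) =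
(Q_jA)(b) for b ∈ Λ_j (2.20)»*; [BalabanImbrieJaffe1985] (2.13) p. 304 (the one-step average over the straight contours, = [I] (1.11)).
[Balaban1985BackgroundPropagators] p. 428: *«C*Δ_kC with a lower bound γ₀ > 0 independent of k and U. We have proved it in [4], Lemma 2.4, for
operators with U = 1»* (the sentence this chain serves; its (3.156) `Δ_k(1) = (QG₁Q*)⁻¹(1) − a` is def-Y's `Node00.OpsYSectE.deltaKY_one_v3`, whose
`(QGQ*)⁻¹(1)` IS the lift of this file's `EE` by n06-i's `B9Eq3132SectDLetters.QGQinvY_one_liftEndY`).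

WHY THIS FILE (cell `pub-ymgap`, D-0062, node N08 [Balaban1985UV3] row `h324c` ∕ node N06 G-B9-09; seat dag-n08-b gen 36, CLAIM-16; node00-def-Y's
LOCATED-D153 decomposition).  The `U = 1` precision doors of the lineage (`…PrecisionDoorIneq2153AtOne`) display [4] (2.153) for the GENUINE multi-level
operator `(QGQ*)⁻¹ − a` of NODE 00 as a hypothesis.  The tree's (2.153) (`B6LowerBound2153Torus`, `B6Cov2156TorusDelK`) is the ONE-LEVEL torus
statement for the Fourier-defined form (1.66) resp. the β cell's `DelK`, and the dictionary «NODE 00's position-space `(QGQ*)⁻¹(1) − a` = [I]'s momentum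
representation (1.58)–(1.66)» was sized XL (def-Y, LOCATED-D153 (D3)).  THIS FILE REPLACES THAT ROUTE BY A POSITION-SPACE ONE that holds for EVERY
nested family `{Λ_j}` (the lower levels only add constraints): (1.65) itself — the Schur complement read at the critical configuration `HB` of (2.35),
whose admissibility `QHB = B`, `R∂*HB = 0` is p21's `isCritical_hOp_V1` — gives `⟨B,(QGQ*)⁻¹B⟩ − ⟨B,aB⟩ = ‖∂(HB)‖²` EXACTLY; and the lower bound of
(1.67)∕(2.118) with `γ₀ = 1` is Jensen's inequality on p11's Stokes identity `BIJ85TreeGaugeLineSums.curl_bondAvg_eq` («the curl of a block average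
is an average of fluxes»), iterated to the top torus, where the multi-scale constraints `Q_jHB = 0` on `Λ_j` (`j < k`), `Q_kHB = B` on `Λ_k` determine
`Q_kHB` on EVERY bond of `T^{(k)}` (p21's Lemma V `B6SectADomainsV1.bondAvgIter_eq_zero_of_constr_zero`, re-run below the top level).  Composing with
[4] Lemma 2.4 (2.128) on the top torus (`B6Lemma24Torus.lemma24_torus`, transported in the companion `B6Lemma24TopTorusV1`) yields (2.153) for the
multi-level operator; the lift to NODE 00's `M_N(ℂ)`-valued letters is the companion `…PrecisionDoorGamma0AtOne`.  Nothing of pub-balaban's ∕ p21's ∕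
p11's files is restated: `EE`, `GE`, `QsE`, `QE`, `deltaAE`, `hOp`, `bondAvg`, `bondAvgIter`, `curl`, `Domains`, `LamBond`, `Deep` are used BY NAME.

WHAT IS PROVED (0 `sorry`, 0 `def`, standard axioms; every nested family `D : Domains P`, lattice factor `c ≠ 0`, weights `w > 0`; V1 conventions —
ℓ² pairings without the volume factor, `curl 1` = the plaquette circulation of [I] (1.2)).
* §1 ★★ `inner_EE_eq` — **`⟨B,(QGQ*)⁻¹B⟩ = ‖∂_c(HB)‖² + Σ_𝔅 w·B²`** (`H = GQ*(QGQ*)⁻¹`): (1.65) for the multi-level operator, the `a`-term split off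
  ((3.156)'s `(QG₁Q*)⁻¹ − a` at `U = 1` is therefore the non-negative form `‖∂(HB)‖²`).
* §2 `sum_plaq_eq`, `sum_blockSite_eq`, `sum_runSite_eq` (re-indexing sums over plaquettes ∕ blocks ∕ translates); ★ `curl_bondAvg_eq_sum_curl`
  (`(∂QA)(p′) = L^{−(d+1)}Σ_{x∈B(p′₋)}Σ_{s,t<L}(∂A)(x+se_ν+te_μ; μ,ν)`, p11's identity with the signs resolved); ★ `curl_bondAvg_sq_le` (Cauchy–Schwarz);
  ★★ `sum_curl_bondAvg_sq_le` — **`Σ_{p′⊂T^{(j+1)}}(∂QA)(p′)² ≤ L^{2−d}·Σ_{p⊂T^{(j)}}(∂A)(p)²`**; ★★ `sum_curl_bondAvgIter_sq_le` — `Σ_{P⊂T^{(k)}}(∂Q_kA)(P)² ≤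
  (L^{2−d})^k·Σ_{p⊂T^{(0)}}(∂A)(p)²` (the lower (1.67) with `γ₀ = 1` in V1 units: `∂₁Q_k = M_k∂` with `‖M_k‖ ≤ 1` in print's `η`-weighted norms).
* §3 ★ `bondAvgIter_eq_zero_below_of_constr` (Lemma V below the top level: `Q_jA = 0` on `Λ_j` for all `j < k` ⇒ `(Q_jA)(b) = 0` on every `j`-bond, `j < k`,
  with no end point inside `Ω_{j+1}`); ★★ `bondAvgIter_top_eq_of_constr` — with moreover `Q_kA = B_k` on `Λ_k`: **`Q_kA = B̂` on EVERY bond of `T^{(k)}`**,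
  `B̂` the extension of `B_k` by zero.
* §4 `normSq_dcE_eq_sum`; ★★★ **`ineq2118_lower_multiLevel`** — for `B ∈ L²(𝔅)` vanishing on the index bonds of level `< k` and `B̂ : T^{(k)}`-bonds `→ ℝ`
  its top-level reading extended by zero: **`c²·(L^{d−2})^k·Σ_{P⊂T^{(k)}}(∂B̂)(P)² ≤ ⟨B,(QGQ*)⁻¹B⟩ − Σ_𝔅 w·B²`**.

HONEST SCOPE.  Kernel algebra ∕ combinatorics over landed V1 theorems; `U = 1` only (the operator is [4]'s, = [Balaban1985BackgroundPropagators]'s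
(3.156) at the trivial background by the cited def-Y ∕ n06-i identities, which are NOT re-proved here); the constant `γ₀ = 1` and the factor
`(L^{d−2})^k` are in V1's flat units (print's `η^{d+1}`-weighted (1.67) has `d`-only constants; the rescaling is the consumer's `etaDY`); the upper half
of (1.67), Lemma 2.4 and (2.153) themselves are NOT in this file; nothing about `U ≠ 1`, the continuum, OS or the mass gap.  Count-neutral Literature
helper; node N06 ∕ N08 NOT discharged.
-/

open scoped InnerProductSpace

namespace Literature.MathematicalPhysics.QuantumFieldTheory.Balaban1983to89.B6Ineq2118LowerMultiLevelV1

open LatticeFieldCalculus B6SectADomainsV1 B6SectAOperatorsV1 B6SectAVectorModelV1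
open BalabanImbrieJaffe1984to88.BIJ85AxialPropagator411 (BondSpace PlaqSpace)

noncomputable section

variable {P : Params} (D : Domains P)

/-! ## §1 (1.65) for the multi-level operator: the Schur step `⟨B,(QGQ*)⁻¹B⟩ − ⟨B,aB⟩ = ‖∂(HB)‖²` -/

/-- ★★ **`⟨B,(QGQ*)⁻¹B⟩ = ‖∂_c(HB)‖² + Σ_{b∈𝔅} w(b)B(b)²`**, `H = GQ*(QGQ*)⁻¹` (2.35): since `QHB = B` and `R∂*HB = 0` (p21's `isCritical_hOp_V1`) and
`Δ_aHB = Q*(QGQ*)⁻¹B`, `⟨B,(QGQ*)⁻¹B⟩ = ⟨HB, Δ_aHB⟩ = ‖∂HB‖² + ‖R∂*HB‖² + ⟨QHB, aQHB⟩` (2.19) — (1.65) *«⟨B, Δ_kB⟩ = ⟨∂H_kB, ∂H_kB⟩»* for the operator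
`Δ_k = (QGQ*)⁻¹ − a` of every nested family. [cite: Balaban1984PropagatorsI, (1.65) p.29; Balaban1984PropagatorsII, (2.19) p.226, (2.35) p.228, (2.118) p.243; Balaban1985BackgroundPropagators, (3.156) p.428] -/
theorem inner_EE_eq {c : ℝ} (hc : c ≠ 0) {w : BondIdx D → ℝ} (hw : ∀ i, 0 < w i) (B : BondIdxSpace D) :
    ⟪B, EE D hc hw B⟫_ℝ =
      ‖dcE c (B6SectA.hOp (GE D hc hw) (QsE D) (EE D hc hw) B)‖ ^ 2 + ∑ i, w i * B i ^ 2 := by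
  set H := B6SectA.hOp (GE D hc hw) (QsE D) (EE D hc hw) B with hH
  have hadm := (B6SectACriticalPointV1.isCritical_hOp_V1 D hc hw B).1
  have hQ : QE D H = B := hadm.1
  have hR : RE D c (dsE c H) = 0 := hadm.2
  have hform : ⟪B, EE D hc hw B⟫_ℝ = ⟪H, deltaAE D c w H⟫_ℝ := by
    have h1 : deltaAE D c w H = QsE D (EE D hc hw B) := by
      rw [hH, B6SectA.hOp, LinearMap.comp_apply, LinearMap.comp_apply, deltaAE_GE]
    rw [h1, real_inner_comm (QsE D (EE D hc hw B)) H, inner_QsE_left, hQ]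
    exact (real_inner_comm _ _).symm
  rw [hform, inner_deltaAE_self, hR, norm_zero, zero_pow two_ne_zero, add_zero, hQ]

/-! ## §2 The lower (1.67) ∕ (2.118) by Jensen: `Σ_{p′⊂T^{(j+1)}}(∂QA)(p′)² ≤ L^{2−d}·Σ_{p⊂T^{(j)}}(∂A)(p)²` -/

section Jensen

variable {j : ℕ}
open BalabanImbrieJaffe1984to88.BIJ85TreeGaugeLineSums (pcirc sweepFlux pcirc_eq_neg_curl curl_bondAvg_eq card_offsets
  runSite_apply_self runSite_apply_ne)
open Finset

/-- a sum over the plaquettes of `T^{(j)}` is a sum over base points and ordered direction pairs `μ < ν` (the `½Σ_{μ,ν}` of (1.66)).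
[cite: Balaban1984PropagatorsI, (1.2) p.18, (1.66) p.29, bookkeeping] -/
theorem sum_plaq_eq {α : Type*} [AddCommMonoid α] (g : Plaq P j → α) :
    ∑ p : Plaq P j, g p = ∑ x : Site P j, ∑ q : {q : Fin P.d × Fin P.d // q.1 < q.2}, g ⟨x, q.1.1, q.1.2, q.2⟩ := by
  let e : Plaq P j ≃ Site P j × {q : Fin P.d × Fin P.d // q.1 < q.2} :=
    ⟨fun p => (p.src, ⟨(p.μ, p.ν), p.hμν⟩), fun t => ⟨t.1, t.2.1.1, t.2.1.2, t.2.2⟩, fun _ => rfl, fun _ => rfl⟩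
  rw [← Fintype.sum_prod_type', ← e.symm.sum_comp]
  rfl

/-- a sum over the blocks `B(y)`, `y ∈ T^{(j+1)}`, parametrised by their offsets, is a sum over `T^{(j)}` (the blocks partition the fine torus; standing range).
[cite: Balaban1984PropagatorsI, (1.5)–(1.6) p.18, bookkeeping] -/
theorem sum_blockSite_eq (hj : j + 1 ≤ P.m + P.K) {α : Type*} [AddCommMonoid α] (F : Site P j → α) :
    ∑ y : Site P (j + 1), ∑ r : Fin P.d → Fin P.L, F (Site.blockSite y r) = ∑ x : Site P j, F x := by
  have hinj : Function.Injective (fun yr : Site P (j + 1) × (Fin P.d → Fin P.L) => Site.blockSite yr.1 yr.2) := by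
    rintro ⟨y, r⟩ ⟨y', r'⟩ h
    obtain ⟨h1, h2⟩ := AveragingRT.blockSite_inj hj (show Site.blockSite y r = Site.blockSite y' r' from h)
    rw [h1, h2]
  have hcard : Fintype.card (Site P (j + 1) × (Fin P.d → Fin P.L)) = Fintype.card (Site P j) := by
    rw [Fintype.card_prod, card_offsets, Site.card_site_eq_mul_succ hj, mul_comm]
  have hbij : Function.Bijective (fun yr : Site P (j + 1) × (Fin P.d → Fin P.L) => Site.blockSite yr.1 yr.2) :=
    (Fintype.bijective_iff_injective_and_card _).mpr ⟨hinj, hcard⟩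
  rw [← Fintype.sum_prod_type']
  exact Fintype.sum_bijective _ hbij _ _ fun _ => rfl

/-- translation by `t·e_μ` is a permutation of `T^{(j)}`: sums are invariant. [cite: Balaban1984PropagatorsI, (1.7) p.18, bookkeeping] -/
theorem sum_runSite_eq (μ : Fin P.d) (t : ℕ) {α : Type*} [AddCommMonoid α] (F : Site P j → α) :
    ∑ x : Site P j, F (runSite x μ t) = ∑ x : Site P j, F x := by
  have hinj : Function.Injective (fun x : Site P j => runSite x μ t) := by
    intro x y h
    replace h : runSite x μ t = runSite y μ t := h
    funext κ
    by_cases hκ : κ = μ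
    · subst hκ
      have := congr_fun h κ
      rw [runSite_apply_self, runSite_apply_self] at this
      exact add_right_cancel this
    · have := congr_fun h κ
      rwa [runSite_apply_ne _ hκ, runSite_apply_ne _ hκ] at this
  exact Fintype.sum_bijective _ (Finite.injective_iff_bijective.mp hinj) _ _ fun _ => rfl

/-- ★ **THE CURL OF A BLOCK AVERAGE IS AN AVERAGE OF PLAQUETTE VARIABLES**: for the coarse plaquette `p′ = ⟨y; μ < ν⟩` of `T^{(j+1)}`,
`(∂QA)(p′) = L^{−(d+1)}·Σ_{x∈B(y)}Σ_{s<L}Σ_{t<L}(∂A)(⟨x + se_ν + te_μ; μ, ν⟩)` — p11's Stokes identity `curl_bondAvg_eq` with the oriented circulations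
resolved to `Setup`'s plaquette variable. [cite: BalabanImbrieJaffe1985, (2.13) p.304; Balaban1984PropagatorsI, (1.11) p.19, (1.2) p.18] -/
theorem curl_bondAvg_eq_sum_curl (hj : j + 1 ≤ P.m + P.K) (A : VecField P j ℝ) (p' : Plaq P (j + 1)) :
    curl 1 (bondAvg A) p' =
      ((P.L : ℝ) ^ (P.d + 1))⁻¹ * ∑ r : Fin P.d → Fin P.L, ∑ s ∈ range P.L, ∑ t ∈ range P.L,
        curl 1 A ⟨runSite (runSite (Site.blockSite p'.src r) p'.ν s) p'.μ t, p'.μ, p'.ν, p'.hμν⟩ := by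
  rw [curl_bondAvg_eq hj]
  congr 1
  refine sum_congr rfl fun r _ => ?_
  simp only [segSum, sweepFlux, runBond, sum_neg_distrib, neg_neg, pcirc_eq_neg_curl A _ p'.hμν]

/-- ★ **JENSEN AT ONE COARSE PLAQUETTE**: `(∂QA)(p′)² ≤ L^{−d}·Σ_{x∈B(y)}Σ_{s,t<L}(∂A)(⟨x + se_ν + te_μ; μ, ν⟩)²` (Cauchy–Schwarz over the `L^{d+2}` fine
plaquettes of the average). [cite: BalabanImbrieJaffe1985, (2.13) p.304; Balaban1984PropagatorsI, (1.67) p.29] -/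
theorem curl_bondAvg_sq_le (hj : j + 1 ≤ P.m + P.K) (A : VecField P j ℝ) (p' : Plaq P (j + 1)) :
    curl 1 (bondAvg A) p' ^ 2 ≤
      ((P.L : ℝ) ^ P.d)⁻¹ * ∑ r : Fin P.d → Fin P.L, ∑ s ∈ range P.L, ∑ t ∈ range P.L,
        curl 1 A ⟨runSite (runSite (Site.blockSite p'.src r) p'.ν s) p'.μ t, p'.μ, p'.ν, p'.hμν⟩ ^ 2 := by
  have hL : (0 : ℝ) < P.L := Nat.cast_pos.mpr P.L_pos
  set c : (Fin P.d → Fin P.L) → ℕ → ℕ → ℝ := fun r s t =>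
    curl 1 A ⟨runSite (runSite (Site.blockSite p'.src r) p'.ν s) p'.μ t, p'.μ, p'.ν, p'.hμν⟩ with hc
  rw [curl_bondAvg_eq_sum_curl hj, mul_pow]
  -- three nested Cauchy–Schwarz steps
  have h3 : ∀ r s, (∑ t ∈ range P.L, c r s t) ^ 2 ≤ P.L * ∑ t ∈ range P.L, c r s t ^ 2 := fun r s => by
    have := sq_sum_le_card_mul_sum_sq (s := range P.L) (f := fun t => c r s t)
    rwa [card_range] at this
  have h2 : ∀ r, (∑ s ∈ range P.L, ∑ t ∈ range P.L, c r s t) ^ 2 ≤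
      (P.L : ℝ) * P.L * ∑ s ∈ range P.L, ∑ t ∈ range P.L, c r s t ^ 2 := fun r => by
    calc (∑ s ∈ range P.L, ∑ t ∈ range P.L, c r s t) ^ 2
        ≤ P.L * ∑ s ∈ range P.L, (∑ t ∈ range P.L, c r s t) ^ 2 := by
          have := sq_sum_le_card_mul_sum_sq (s := range P.L) (f := fun s => ∑ t ∈ range P.L, c r s t)
          rwa [card_range] at this
      _ ≤ P.L * ∑ s ∈ range P.L, (P.L * ∑ t ∈ range P.L, c r s t ^ 2) :=
          mul_le_mul_of_nonneg_left (sum_le_sum fun s _ => h3 r s) hL.le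
      _ = (P.L : ℝ) * P.L * ∑ s ∈ range P.L, ∑ t ∈ range P.L, c r s t ^ 2 := by rw [← mul_sum, mul_assoc]
  have h1 : (∑ r : Fin P.d → Fin P.L, ∑ s ∈ range P.L, ∑ t ∈ range P.L, c r s t) ^ 2 ≤
      (P.L : ℝ) ^ P.d * ((P.L : ℝ) * P.L) * ∑ r : Fin P.d → Fin P.L, ∑ s ∈ range P.L, ∑ t ∈ range P.L, c r s t ^ 2 := by
    calc (∑ r : Fin P.d → Fin P.L, ∑ s ∈ range P.L, ∑ t ∈ range P.L, c r s t) ^ 2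
        ≤ (P.L : ℝ) ^ P.d * ∑ r : Fin P.d → Fin P.L, (∑ s ∈ range P.L, ∑ t ∈ range P.L, c r s t) ^ 2 := by
          have := sq_sum_le_card_mul_sum_sq (s := (univ : Finset (Fin P.d → Fin P.L)))
            (f := fun r => ∑ s ∈ range P.L, ∑ t ∈ range P.L, c r s t)
          rwa [card_univ, card_offsets, Nat.cast_pow] at this
      _ ≤ (P.L : ℝ) ^ P.d * ∑ r : Fin P.d → Fin P.L, ((P.L : ℝ) * P.L * ∑ s ∈ range P.L, ∑ t ∈ range P.L, c r s t ^ 2) :=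
          mul_le_mul_of_nonneg_left (sum_le_sum fun r _ => h2 r) (by positivity)
      _ = _ := by rw [← mul_sum, mul_assoc]; ring
  calc (((P.L : ℝ) ^ (P.d + 1))⁻¹) ^ 2 * (∑ r : Fin P.d → Fin P.L, ∑ s ∈ range P.L, ∑ t ∈ range P.L, c r s t) ^ 2
      ≤ (((P.L : ℝ) ^ (P.d + 1))⁻¹) ^ 2 *
          ((P.L : ℝ) ^ P.d * ((P.L : ℝ) * P.L) * ∑ r : Fin P.d → Fin P.L, ∑ s ∈ range P.L, ∑ t ∈ range P.L, c r s t ^ 2) :=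
        mul_le_mul_of_nonneg_left h1 (by positivity)
    _ = ((P.L : ℝ) ^ P.d)⁻¹ * ∑ r : Fin P.d → Fin P.L, ∑ s ∈ range P.L, ∑ t ∈ range P.L, c r s t ^ 2 := by
        rw [← mul_assoc]
        congr 1
        field_simp
        ring

/-- reordering a fourfold sum. [folklore] -/
private theorem sum_reorder4 {Y R α : Type*} [Fintype Y] [Fintype R] [AddCommMonoid α] (n : ℕ) (F : Y → R → ℕ → ℕ → α) :
    ∑ y, ∑ r, ∑ s ∈ range n, ∑ t ∈ range n, F y r s t = ∑ s ∈ range n, ∑ t ∈ range n, ∑ y, ∑ r, F y r s t :=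
  calc ∑ y, ∑ r, ∑ s ∈ range n, ∑ t ∈ range n, F y r s t
      = ∑ y, ∑ s ∈ range n, ∑ r, ∑ t ∈ range n, F y r s t := sum_congr rfl fun _ _ => Finset.sum_comm
    _ = ∑ y, ∑ s ∈ range n, ∑ t ∈ range n, ∑ r, F y r s t :=
        sum_congr rfl fun _ _ => sum_congr rfl fun _ _ => Finset.sum_comm
    _ = ∑ s ∈ range n, ∑ y, ∑ t ∈ range n, ∑ r, F y r s t := Finset.sum_comm
    _ = ∑ s ∈ range n, ∑ t ∈ range n, ∑ y, ∑ r, F y r s t := sum_congr rfl fun _ _ => Finset.sum_comm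

/-- ★★ **ONE STEP OF THE LOWER (1.67)**: `Σ_{p′⊂T^{(j+1)}}(∂QA)(p′)² ≤ L^{2−d}·Σ_{p⊂T^{(j)}}(∂A)(p)²` — each fine plaquette of the plane `(μ,ν)` lies in
exactly `L²` of the averaged `L × L` squares (re-indexing by `sum_blockSite_eq` and two translations). [cite: Balaban1984PropagatorsI, (1.67) p.29; Balaban1984PropagatorsII, (2.118) p.243] -/
theorem sum_curl_bondAvg_sq_le (hj : j + 1 ≤ P.m + P.K) (A : VecField P j ℝ) :
    ∑ p' : Plaq P (j + 1), curl 1 (bondAvg A) p' ^ 2 ≤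
      ((P.L : ℝ) ^ P.d)⁻¹ * (P.L : ℝ) ^ 2 * ∑ p : Plaq P j, curl 1 A p ^ 2 := by
  have hL : (0 : ℝ) < P.L := Nat.cast_pos.mpr P.L_pos
  rw [sum_plaq_eq, sum_plaq_eq (j := j)]
  calc ∑ y : Site P (j + 1), ∑ q : {q : Fin P.d × Fin P.d // q.1 < q.2}, curl 1 (bondAvg A) ⟨y, q.1.1, q.1.2, q.2⟩ ^ 2
      ≤ ∑ y : Site P (j + 1), ∑ q : {q : Fin P.d × Fin P.d // q.1 < q.2},
          ((P.L : ℝ) ^ P.d)⁻¹ * ∑ r : Fin P.d → Fin P.L, ∑ s ∈ range P.L, ∑ t ∈ range P.L,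
            curl 1 A ⟨runSite (runSite (Site.blockSite y r) q.1.2 s) q.1.1 t, q.1.1, q.1.2, q.2⟩ ^ 2 :=
        sum_le_sum fun y _ => sum_le_sum fun q _ => curl_bondAvg_sq_le hj A ⟨y, q.1.1, q.1.2, q.2⟩
    _ = ((P.L : ℝ) ^ P.d)⁻¹ * ∑ q : {q : Fin P.d × Fin P.d // q.1 < q.2}, ∑ s ∈ range P.L, ∑ t ∈ range P.L,
          ∑ y : Site P (j + 1), ∑ r : Fin P.d → Fin P.L,
            curl 1 A ⟨runSite (runSite (Site.blockSite y r) q.1.2 s) q.1.1 t, q.1.1, q.1.2, q.2⟩ ^ 2 := by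
        rw [Finset.sum_comm (s := (univ : Finset (Site P (j + 1)))) (t := (univ : Finset {q : Fin P.d × Fin P.d // q.1 < q.2})),
          mul_sum]
        refine sum_congr rfl fun q _ => ?_
        rw [← mul_sum, sum_reorder4]
    _ = ((P.L : ℝ) ^ P.d)⁻¹ * ∑ q : {q : Fin P.d × Fin P.d // q.1 < q.2}, ∑ _s ∈ range P.L, ∑ _t ∈ range P.L,
          ∑ z : Site P j, curl 1 A ⟨z, q.1.1, q.1.2, q.2⟩ ^ 2 := by
        congr 1
        refine sum_congr rfl fun q _ => sum_congr rfl fun s _ => sum_congr rfl fun t _ => ?_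
        rw [sum_blockSite_eq hj (fun x => curl 1 A ⟨runSite (runSite x q.1.2 s) q.1.1 t, q.1.1, q.1.2, q.2⟩ ^ 2),
          sum_runSite_eq q.1.2 s (fun x => curl 1 A ⟨runSite x q.1.1 t, q.1.1, q.1.2, q.2⟩ ^ 2),
          sum_runSite_eq q.1.1 t (fun x => curl 1 A ⟨x, q.1.1, q.1.2, q.2⟩ ^ 2)]
    _ = ((P.L : ℝ) ^ P.d)⁻¹ * (P.L : ℝ) ^ 2 *
          ∑ z : Site P j, ∑ q : {q : Fin P.d × Fin P.d // q.1 < q.2}, curl 1 A ⟨z, q.1.1, q.1.2, q.2⟩ ^ 2 := by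
        rw [Finset.sum_comm (s := (univ : Finset (Site P j))) (t := (univ : Finset {q : Fin P.d × Fin P.d // q.1 < q.2})),
          mul_assoc, mul_sum (a := (P.L : ℝ) ^ 2)]
        congr 1
        refine sum_congr rfl fun q _ => ?_
        rw [sum_const, card_range, sum_const, card_range, smul_smul, nsmul_eq_mul]
        push_cast
        ring

/-- ★★ **THE LOWER (1.67) FOR `Q_k` WITH `γ₀ = 1` (V1 units)**: `Σ_{P⊂T^{(k)}}(∂Q_kA)(P)² ≤ (L^{2−d})^k·Σ_{p⊂T^{(0)}}(∂A)(p)²` (iteration along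
`Q_k = Q∘Q_{k−1}` (1.16); standing range `k ≤ m + K`). [cite: Balaban1984PropagatorsI, (1.16)–(1.18) p.20, (1.67) p.29; Balaban1984PropagatorsII, (2.118) p.243] -/
theorem sum_curl_bondAvgIter_sq_le : ∀ (k : ℕ), k ≤ P.m + P.K → ∀ (A : VecField P 0 ℝ),
    ∑ p' : Plaq P k, curl 1 (bondAvgIter k A) p' ^ 2 ≤
      (((P.L : ℝ) ^ P.d)⁻¹ * (P.L : ℝ) ^ 2) ^ k * ∑ p : Plaq P 0, curl 1 A p ^ 2
  | 0, _, A => by rw [B5Eq120IterProof.bondAvgIter_zero, pow_zero, one_mul]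
  | k + 1, hk, A => by
    rw [B5Eq120IterProof.bondAvgIter_succ, pow_succ, mul_comm (_ ^ k), mul_assoc]
    exact (sum_curl_bondAvg_sq_le hk _).trans
      (mul_le_mul_of_nonneg_left (sum_curl_bondAvgIter_sq_le k (by omega) A) (by positivity))

end Jensen

/-! ## §3 Constraint propagation: `QA = B` with `B = 0` below the top level determines `Q_kA` on EVERY bond of `T^{(k)}` -/

section Propagation

open B5Eq120IterProof (bondAvgIter_zero bondAvgIter_succ)
open B5AveragingLocalityV1 (bondAvg_eq_zero_of_local)
open BalabanImbrieJaffe1984to88.BIJ85AxialPropagator411 (bondAvg_zero)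

/-- ★ **LEMMA V BELOW THE TOP LEVEL**: if `Q_jA = 0` on `Λ_j` for every `j < k`, then `(Q_jA)(b) = 0` for every `j < k` and every `j`-bond `b` with no
end point inside `Ω_{j+1}` (p21's `bondAvgIter_eq_zero_of_constr_zero` re-run without the level-`k` hypothesis: `Q_j = Q∘Q_{j−1}` averages over straight
contours whose bonds join sub-blocks not inside `Ω_j`, `B5AveragingLocalityV1.bondAvg_eq_zero_of_local`). [cite: Balaban1984PropagatorsII, (2.6) p.224, (2.20) p.226] -/
theorem bondAvgIter_eq_zero_below_of_constr {A : VecField P 0 ℝ}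
    (hA : ∀ (j : ℕ) (b : PBond P j), j < D.k → D.LamBond j b → bondAvgIter j A b = 0) :
    ∀ (j : ℕ), j < D.k → ∀ (b : PBond P j), ¬ D.Deep j b.src → ¬ D.Deep j b.tgt → bondAvgIter j A b = 0
  | 0, h0, b, hs, ht => hA 0 b h0 ((D.lamBond_zero_iff b).mpr ⟨hs, ht⟩)
  | j + 1, hj1, b, hs, ht => by
    by_cases hmem : b.src ∈ D.Om (j + 1) ∨ b.tgt ∈ D.Om (j + 1)
    · exact hA (j + 1) b hj1 ⟨hmem, hs, ht⟩
    · obtain ⟨hm1, hm2⟩ := not_or.mp hmem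
      have hnd : ∀ z : Site P j, (blockOf z = b.src ∨ blockOf z = b.tgt) → ¬ D.Deep j z := by
        rintro z (hz | hz)
        · simpa [Domains.Deep, hz] using hm1
        · simpa [Domains.Deep, hz] using hm2
      rw [bondAvgIter_succ]
      have hj : j + 1 ≤ P.m + P.K := le_trans hj1.le D.hk
      exact bondAvg_eq_zero_of_local hj _ b fun b' h1 h2 =>
        bondAvgIter_eq_zero_below_of_constr hA j (Nat.lt_of_succ_lt hj1) b' (hnd _ h1) (hnd _ h2)

/-- ★★ **THE MULTI-SCALE CONSTRAINTS DETERMINE `Q_kA` ON THE WHOLE TOP TORUS**: `Q_jA = 0` on `Λ_j` (`j < k`) and `Q_kA = B_k` on `Λ_k` give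
`(Q_kA)(b) = B̂(b)` for EVERY bond `b` of `T^{(k)}`, `B̂ = B_k` on `Λ_k` and `0` elsewhere (a top bond outside `Λ_k = st_k(Ω_k^{(k)})` has both end blocks
outside `Ω_k^{(k)}`, so its average sees only `(k−1)`-bonds with no end point inside `Ω_k`, where Lemma V applies). [cite: Balaban1984PropagatorsII, (2.3) p.224, (2.6) p.224, (2.20) p.226, (2.153) p.249 («on the whole lattice T^{(k)}»)] -/
theorem bondAvgIter_top_eq_of_constr {A : VecField P 0 ℝ} {Bk : PBond P D.k → ℝ}
    (hlow : ∀ (j : ℕ) (b : PBond P j), j < D.k → D.LamBond j b → bondAvgIter j A b = 0)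
    (htop : ∀ b : PBond P D.k, D.LamBond D.k b → bondAvgIter D.k A b = Bk b)
    (hoff : ∀ b : PBond P D.k, ¬ D.LamBond D.k b → Bk b = 0) (b : PBond P D.k) :
    bondAvgIter D.k A b = Bk b := by
  by_cases hb : D.LamBond D.k b
  · exact htop b hb
  rw [hoff b hb]
  have hmem : ¬ (b.src ∈ D.Om D.k ∨ b.tgt ∈ D.Om D.k) := fun h => hb ((D.lamBond_top_iff b).mpr h)
  obtain ⟨hm1, hm2⟩ := not_or.mp hmem
  -- `k = 0` is impossible (`Ω₀ = T`); write `k = j + 1`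
  obtain ⟨j, hj⟩ : ∃ j, D.k = j + 1 := by
    rcases Nat.eq_zero_or_eq_succ_pred D.k with h0 | h
    · exfalso; apply hm1
      have : D.Om D.k = Finset.univ := by rw [h0]; exact D.Om_zero
      rw [this]; exact Finset.mem_univ _
    · exact ⟨_, h⟩
  -- transport the statement along `D.k = j + 1`
  revert b
  rw [hj]
  intro b hb hmem hm1 hm2
  have hnd : ∀ z : Site P j, (blockOf z = b.src ∨ blockOf z = b.tgt) → ¬ D.Deep j z := by
    rintro z (hz | hz)
    · simpa [Domains.Deep, hz] using hm1
    · simpa [Domains.Deep, hz] using hm2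
  rw [bondAvgIter_succ]
  have hjK : j + 1 ≤ P.m + P.K := hj ▸ D.hk
  exact bondAvg_eq_zero_of_local hjK _ b fun b' h1 h2 =>
    bondAvgIter_eq_zero_below_of_constr D hlow j (by omega) b' (hnd _ h1) (hnd _ h2)

end Propagation

/-! ## §4 Assembly: the lower (2.118) for the multi-level `(QGQ*)⁻¹ − a`, read on the top torus -/

section Assembly

open B5Eq120IterProof (bondAvgIter_zero bondAvgIter_succ)

/-- `‖∂_cA‖² = c²·Σ_{p⊂T^{(0)}}(∂A)(p)²` (the lattice factor of the plaquette variable; = C4's `B6SectALemma24OneLevelV1.normSq_dcE_eq`, re-derived from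
`inner_eq_sum` to keep this file's imports at p21 ∕ p11). [cite: Balaban1984PropagatorsI, (1.2)–(1.4) p.18; Balaban1984PropagatorsII, (2.5) p.224] -/
theorem normSq_dcE_eq_sum (c : ℝ) (x : BondSpace P) :
    ‖dcE c x‖ ^ 2 = c ^ 2 * ∑ p : Plaq P 0, curl 1 (WithLp.ofLp x) p ^ 2 := by
  rw [← real_inner_self_eq_norm_sq, inner_eq_sum, Finset.mul_sum]
  refine Finset.sum_congr rfl fun p _ => ?_
  rw [dcE_apply]
  simp only [curl, smul_eq_mul, one_mul]
  ring

/-- ★★★ **THE LOWER (2.118) FOR THE MULTI-LEVEL `Δ_k = (QGQ*)⁻¹ − a`, READ ON `T^{(k)}`**: for every nested family `{Λ_j}` (`D`), `c ≠ 0`, `w > 0`, every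
`B ∈ L²(𝔅)` VANISHING on the index bonds of the levels `j < k` (print's situation at the `k`-th step: the variables are the top-level `B`, (2.152)), and
`B̂` its top-level reading extended by zero to all bonds of `T^{(k)}`:
**`c²·(L^d∕L²)^k · Σ_{P⊂T^{(k)}} (∂B̂)(P)² ≤ ⟨B,(QGQ*)⁻¹B⟩ − Σ_𝔅 w·B²`** — §1 at `HB`, §3 (`Q_kHB = B̂` on all of `T^{(k)}`), §2 (Jensen).  With
`c = Lᵏ = η⁻¹` the left constant is `L^{kd}`, and def-Y's print-unit factor `η^{d+1} = L^{−k(d+1)}` turns it into print's `L^{−k}·…` bookkeeping of the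
companion files (the `k`-uniform (2.153) appears after Lemma 2.4). [cite: Balaban1984PropagatorsII, (2.118) p.243, (2.152)–(2.153) p.249, (2.35) p.228; Balaban1984PropagatorsI, (1.65)–(1.67) p.29; Balaban1985BackgroundPropagators, (3.156) p.428] -/
theorem ineq2118_lower_multiLevel {c : ℝ} (hc : c ≠ 0) {w : BondIdx D → ℝ} (hw : ∀ i, 0 < w i) (B : BondIdxSpace D)
    (hB : ∀ i : BondIdx D, (i.1.1 : ℕ) < D.k → B i = 0) (Bk : PBond P D.k → ℝ)
    (hBk : ∀ (b : PBond P D.k) (h : D.LamBond D.k b), Bk b = B ⟨⟨Fin.last D.k, b⟩, h⟩)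
    (hBk0 : ∀ b : PBond P D.k, ¬ D.LamBond D.k b → Bk b = 0) :
    c ^ 2 * ((P.L : ℝ) ^ P.d * ((P.L : ℝ) ^ 2)⁻¹) ^ D.k * ∑ p : Plaq P D.k, curl 1 Bk p ^ 2 ≤
      ⟪B, EE D hc hw B⟫_ℝ - ∑ i, w i * B i ^ 2 := by
  have hL : (0 : ℝ) < P.L := Nat.cast_pos.mpr P.L_pos
  set H := B6SectA.hOp (GE D hc hw) (QsE D) (EE D hc hw) B with hH
  have hQ : QE D H = B := (B6SectACriticalPointV1.isCritical_hOp_V1 D hc hw B).1.1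
  -- the constraints read on functions
  have hQ' : ∀ (j : ℕ) (b : PBond P j) (h : D.LamBond j b),
      bondAvgIter j (WithLp.ofLp H) b = B ⟨⟨⟨j, Nat.lt_succ_of_le (D.le_of_lamBond h)⟩, b⟩, h⟩ := fun j b h => by
    have := congrArg (fun g : BondIdxSpace D => g ⟨⟨⟨j, Nat.lt_succ_of_le (D.le_of_lamBond h)⟩, b⟩, h⟩) hQ
    simpa using this
  have hlow : ∀ (j : ℕ) (b : PBond P j), j < D.k → D.LamBond j b → bondAvgIter j (WithLp.ofLp H) b = 0 :=
    fun j b hj h => by rw [hQ' j b h]; exact hB _ hj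
  have htop : ∀ b : PBond P D.k, D.LamBond D.k b → bondAvgIter D.k (WithLp.ofLp H) b = Bk b := fun b h => by
    rw [hQ' D.k b h, hBk b h]; rfl
  have hQk : bondAvgIter D.k (WithLp.ofLp H) = Bk := funext fun b => bondAvgIter_top_eq_of_constr D hlow htop hBk0 b
  -- Schur + Jensen
  rw [inner_EE_eq D hc hw B, add_sub_cancel_right, normSq_dcE_eq_sum]
  have hJ := sum_curl_bondAvgIter_sq_le D.k D.hk (WithLp.ofLp H)
  rw [hQk] at hJ
  have hρ : (0 : ℝ) < ((P.L : ℝ) ^ P.d)⁻¹ * (P.L : ℝ) ^ 2 := by positivity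
  have hinv : ((P.L : ℝ) ^ P.d * ((P.L : ℝ) ^ 2)⁻¹) = (((P.L : ℝ) ^ P.d)⁻¹ * (P.L : ℝ) ^ 2)⁻¹ := by
    rw [mul_inv, inv_inv]
  rw [hinv, inv_pow, mul_assoc]
  refine mul_le_mul_of_nonneg_left ?_ (sq_nonneg c)
  rw [inv_mul_le_iff₀ (pow_pos hρ _)]
  exact hJ

end Assembly

end

end Literature.MathematicalPhysics.QuantumFieldTheory.Balaban1983to89.B6Ineq2118LowerMultiLevelV1
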